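import Mathlib
import Literature.NumberTheory.LFunctions.Zhang2022.Section15CSmoothMajorant
import HarnessLib

/-!
# Zhang (2022) §15 p. 86: the Rankin cut `n₁ < T` in (15.20) — `Inline15_Rankin` DISCHARGED, and the
# leaf (15.22) reduced to Lemma 15.1 alone

Topic `Literature/NumberTheory/LFunctions/Zhang2022` (Landau–Siegel audit tree; verdict-neutral).
Y. Zhang, *Discrete mean estimates and the Landau–Siegel zero*, arXiv:2211.02515v1 (2022)
[Zhang2022LandauSiegel] — **an unrefereed manuscript under adjudication; nothing here asserts or denies
its Theorems 1–2.** ZHANG-L discharge lane (WP15), leaf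
`h15_22 : Typed.Section15C.Eq15_22 c′ Typed.Section15C.inputs15ABchi`; the inline claim of §15 p. 86
(tex L4257, typed `Typed.Section15B.Inline15_Rankin`):

> Using the Rankin trick (see [14, Section 13.2], for example), we can impose the constraint `n₁ < T`
> to the right side [of (15.20)] with an acceptable error `O(ε₁)`.

* `inline15_Rankin_chi_holds` — **`Typed.Section15B.Inline15_Rankin c′ bChi` holds** (with
  `ε₁ = exp(−𝓛^{1/10}/8)`): the tail `n₁ ≥ T` of `Σ_{n₁∈𝒩(𝒬)} ϖ₁ⱼ(n₁)n₁⁻¹ Σ_{(n,𝒬)=1} b_χ(n₁n)ϖ₁ⱼ(n)/n`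
  is at most `32|C_b|𝓛³⁶ · Σ_{n₁∈𝒩(𝒬), n₁≥T} τ₂(n₁)|ϖ₁ⱼ(n₁)|/n₁` (inner sums by `|b| ≤ C_bτ₂`, (15.21)
  on `n < P` `Typed.Section15B.eq15_21_wide` and `|ϱ*ⱼ(n)| ≤ τ₂(n)`), and by Rankin's trick with
  `δ = 1/(4𝓛)` (`n₁ ≥ T ⇒ 1 ≤ (n₁/T)^δ`, `T^{−δ} = exp(−𝓛^{1/10}/4)`, `p^δ ≤ e` for `p < D⁴`) and the
  Euler-product majorant of `Section15CSmoothMajorant` (`norm_varpi1_le_majorant`,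
  `sum_majorant_le_prod`, `prod_local_factor_le_exp`) that sum is
  `≪ exp(−𝓛^{1/10}/4)·𝓛³⁶·exp(M log(4𝓛))`, eventually `≤ exp(−𝓛^{1/10}/8)`;
* `calS1_eval_of_lemma151` — **leaf `h15_22` REDUCED TO LEMMA 15.1**: E-generic (RT-05 / R-28),
  `[Lemma 15.1 at value E1] → (15.22) at value E1` (all other inputs of `calS1_eval_of_parts` are
  theorems: `smooth_majorant_holds`, `inline15_Rankin_chi_holds`);
* `eq15_22_chi_of_lemma151` — the typed instance: `Skeleton.Lemma151ChiR c′ → Eq15_22 c′ inputs15ABchi`.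

WHAT THIS IS NOT: a proof of Lemma 15.1 (Appendix B, WP15-PLAN legs B1–B5), nor any claim about
Theorems 1–2 of the manuscript or Landau–Siegel zeros.

## References
* Y. Zhang, arXiv:2211.02515v1 (2022), §15 p. 86, (15.20)–(15.22). [cite: Zhang2022LandauSiegel, §15 (15.20) p.86]
* H. Iwaniec, E. Kowalski, *Analytic Number Theory* (2004), §13.2. [cite: IwaniecKowalski2004, §13.2]
-/

noncomputable section

open Complex Real ComplexConjugate Finset
open Literature.NumberTheory.LFunctions.Zhang2022.Skeleton
open Literature.NumberTheory.LFunctions.Zhang2022.Typed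

namespace Literature.NumberTheory.LFunctions.Zhang2022.Typed.Section15C

/-! ## 1. Eventual and elementary inequalities -/

section Prelims

/-- `d(mn) ≤ d(m)d(n)`. [folklore] -/
private theorem card_divisors_mul_le₂ (m n : ℕ) :
    (m * n).divisors.card ≤ m.divisors.card * n.divisors.card := by
  rw [Nat.divisors_mul]
  exact Finset.card_mul_le

/-- `Σ_{1≤n<⌈P⌉} τ₂(n)²/n ≤ 16𝓛³⁶` once `𝓛 ≥ 1` (`(1 + log P)⁴ ≤ (2𝓛⁹)⁴`).
[cite: IwaniecKowalski2004, §1.6 (1.80)] -/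
theorem sum_tau_sq_div_Ico_bigP_le {D : ℕ} (hℓ1 : 1 ≤ ell D) :
    ∑ n ∈ Finset.Ico 1 ⌈bigP D⌉₊, ((n.divisors.card : ℝ)) ^ 2 / n ≤ 16 * ell D ^ 36 := by
  set NP : ℕ := ⌈bigP D⌉₊ with hNP
  have hP1 : ((NP - 1 : ℕ) : ℝ) ≤ bigP D := by
    have hP0 : 0 ≤ bigP D := (Real.exp_pos _).le
    have h := Nat.ceil_lt_add_one hP0
    rcases Nat.eq_zero_or_pos NP with h0 | h0
    · rw [h0]; simpa using hP0
    · rw [Nat.cast_sub h0, Nat.cast_one, hNP]; linarith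
  have hlog : Real.log ((NP - 1 : ℕ) : ℝ) ≤ ell D ^ 9 := by
    rcases Nat.eq_zero_or_pos (NP - 1) with h0 | h0
    · rw [h0, Nat.cast_zero, Real.log_zero]; positivity
    · calc Real.log ((NP - 1 : ℕ) : ℝ) ≤ Real.log (bigP D) :=
            Real.log_le_log (by exact_mod_cast h0) hP1
        _ = ell D ^ 9 := by rw [bigP, Real.log_exp]
  have h9 : (1 : ℝ) ≤ ell D ^ 9 := one_le_pow₀ hℓ1
  have hlog0 := Real.log_natCast_nonneg (NP - 1)
  have hIco : Finset.Ico 1 NP = Finset.Icc 1 (NP - 1) := by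
    ext n; simp only [Finset.mem_Ico, Finset.mem_Icc]; omega
  rw [hIco]
  calc ∑ n ∈ Finset.Icc 1 (NP - 1), ((n.divisors.card : ℝ)) ^ 2 / n
      ≤ (1 + Real.log ((NP - 1 : ℕ) : ℝ)) ^ (2 ^ 2) := sum_card_divisors_pow_div_le_log_pow 2 (NP - 1)
    _ ≤ (ell D ^ 9 + ell D ^ 9) ^ (2 ^ 2) := pow_le_pow_left₀ (by linarith) (by linarith) _
    _ = 16 * ell D ^ 36 := by ring

/-- **Absorbing polynomial factors into `ε₁`**: for any `A, M` and `k`, for all large `D`,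
`A·𝓛ᵏ·exp(M(log(4𝓛) + 4)) ≤ exp(𝓛^{1/10}/8)`. [cite: Zhang2022LandauSiegel, §15 p.86] -/
theorem poly_ell_le_exp_eventually (A M : ℝ) (k : ℕ) :
    ∃ D₁ : ℕ, ∀ D : ℕ, D₁ ≤ D →
      A * ell D ^ k * Real.exp (M * (Real.log (4 * ell D) + 4)) ≤ Real.exp (ell D ^ (1 / 10 : ℝ) / 8) := by
  set M' : ℝ := max M 0 with hM'
  have hM'0 : 0 ≤ M' := le_max_right _ _
  set R : ℝ := 8 * (|A| + 20 * ((k : ℝ) + M') + 6 * M' + 1) with hR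
  have hR0 : 0 ≤ R := by rw [hR]; positivity
  obtain ⟨D₁, hD₁⟩ := exists_nat_forall_le_ell (max 1 (R ^ (20 : ℕ)))
  refine ⟨D₁, fun D hD => ?_⟩
  have hℓ := hD₁ D hD
  have hℓ1 : 1 ≤ ell D := le_trans (le_max_left _ _) hℓ
  have hℓ0 : 0 < ell D := by linarith
  set y : ℝ := ell D ^ (1 / 10 : ℝ) with hy
  have hy0 : 0 < y := Real.rpow_pos_of_pos hℓ0 _
  have hy1 : 1 ≤ y := Real.one_le_rpow hℓ1 (by norm_num)
  have hy10 : y ^ (10 : ℕ) = ell D := by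
    rw [hy, ← Real.rpow_natCast, ← Real.rpow_mul hℓ0.le]; norm_num
  -- `√y ≥ R`
  set r : ℝ := Real.sqrt y with hr
  have hr0 : 0 ≤ r := Real.sqrt_nonneg _
  have hr2 : r ^ 2 = y := Real.sq_sqrt hy0.le
  have hr1 : 1 ≤ r := by rw [hr]; exact Real.one_le_sqrt.mpr hy1
  have hrR : R ≤ r := by
    have h20 : r ^ (20 : ℕ) = ell D := by
      rw [show (20 : ℕ) = 2 * 10 by norm_num, pow_mul, hr2, hy10]
    refine (pow_le_pow_iff_left₀ hR0 hr0 (by norm_num : (20 : ℕ) ≠ 0)).mp ?_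
    rw [h20]; exact le_trans (le_max_right _ _) hℓ
  -- `log 𝓛 ≤ 20 √y`, `log(4𝓛) ≤ 2 + log 𝓛`
  have hlogℓ : Real.log (ell D) ≤ 20 * r := by
    have h1 : Real.log (ell D) = 10 * Real.log y := by
      rw [← hy10, Real.log_pow]; norm_num
    have h2 : Real.log y = 2 * Real.log r := by
      rw [← hr2, Real.log_pow]; norm_num
    have h3 : Real.log r ≤ r - 1 := Real.log_le_sub_one_of_pos (by linarith)
    rw [h1, h2]; linarith
  have hlog4 : Real.log (4 * ell D) ≤ 2 + Real.log (ell D) := by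
    rw [Real.log_mul (by norm_num) hℓ0.ne']
    have : Real.log 4 ≤ 2 := by
      have h := Real.log_le_sub_one_of_pos (show (0:ℝ) < 4 by norm_num)
      have h2 : Real.log 4 = 2 * Real.log 2 := by
        rw [show (4:ℝ) = 2 ^ 2 by norm_num, Real.log_pow]; norm_num
      rw [h2]; linarith [Real.log_two_lt_d9]
    linarith
  -- everything under one exponential
  have hℓk : ell D ^ k = Real.exp (k * Real.log (ell D)) := by
    rw [← Real.exp_log hℓ0, ← Real.exp_nat_mul, Real.log_exp]
  have hexpM : Real.exp (M * (Real.log (4 * ell D) + 4)) ≤ Real.exp (M' * (6 + Real.log (ell D))) := by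
    apply Real.exp_le_exp.mpr
    have hpos : 0 ≤ Real.log (4 * ell D) + 4 := by
      have : 0 ≤ Real.log (4 * ell D) := Real.log_nonneg (by linarith)
      linarith
    calc M * (Real.log (4 * ell D) + 4) ≤ M' * (Real.log (4 * ell D) + 4) :=
          mul_le_mul_of_nonneg_right (le_max_left _ _) hpos
      _ ≤ M' * (6 + Real.log (ell D)) := mul_le_mul_of_nonneg_left (by linarith) hM'0
  have hk0 : 0 ≤ (k : ℝ) * Real.log (ell D) := mul_nonneg (Nat.cast_nonneg k) (Real.log_nonneg hℓ1)
  calc A * ell D ^ k * Real.exp (M * (Real.log (4 * ell D) + 4))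
      ≤ |A| * ell D ^ k * Real.exp (M * (Real.log (4 * ell D) + 4)) := by
        have h0 : 0 ≤ ell D ^ k * Real.exp (M * (Real.log (4 * ell D) + 4)) := by positivity
        nlinarith [le_abs_self A]
    _ ≤ |A| * ell D ^ k * Real.exp (M' * (6 + Real.log (ell D))) :=
        mul_le_mul_of_nonneg_left hexpM (by positivity)
    _ ≤ Real.exp |A| * ell D ^ k * Real.exp (M' * (6 + Real.log (ell D))) := by
        have hA' : |A| ≤ Real.exp |A| := by linarith [Real.add_one_le_exp |A|]
        gcongr
    _ = Real.exp (|A| + k * Real.log (ell D) + M' * (6 + Real.log (ell D))) := by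
        rw [hℓk, ← Real.exp_add, ← Real.exp_add]
    _ ≤ Real.exp (y / 8) := by
        apply Real.exp_le_exp.mpr
        -- `|A| + (k + M')·20 r + 6M' ≤ r·R/8 ≤ r²/8 = y/8`
        have h1 : |A| + k * Real.log (ell D) + M' * (6 + Real.log (ell D)) ≤
            |A| + 20 * ((k : ℝ) + M') * r + 6 * M' := by
          have := mul_le_mul_of_nonneg_left hlogℓ (show 0 ≤ (k : ℝ) + M' by positivity)
          nlinarith
        have h2 : |A| + 20 * ((k : ℝ) + M') * r + 6 * M' ≤ r * (R / 8) := by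
          rw [hR]
          have habs : 0 ≤ |A| := abs_nonneg A
          nlinarith
        have h3 : r * (R / 8) ≤ y / 8 := by rw [← hr2]; nlinarith
        linarith
    _ = Real.exp (ell D ^ (1 / 10 : ℝ) / 8) := by rw [hy]

end Prelims

/-! ## 2. The Rankin cut -/

section Rankin

set_option maxHeartbeats 400000 in
open scoped Classical in
/-- **`Z22` §15 p.86 (tex L4257), the Rankin cut — `Typed.Section15B.Inline15_Rankin c′ bChi` HOLDS**
(with `c = 1/8`, `C = 1`): for all large `D`, under (A), for `1 ≤ j ≤ 3`, removing the terms `n₁ ≥ T`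
from the outer sum of (15.20) costs at most `exp(−𝓛^{1/10}/8)`. Proof: the removed part is
`Σ_{n₁∈𝒩(𝒬), T≤n₁<⌈P⌉} ϖ₁ⱼ(n₁)n₁⁻¹·A(n₁)` with `|A(n₁)| ≤ 32|C_b|𝓛³⁶τ₂(n₁)` (`|b| ≤ C_bτ₂`,
`|ϖ₁ⱼ(n)| ≤ 2τ₂(n)` on the rough `n < P` by (15.21) and `|ϱ*ⱼ| ≤ τ₂`, `Σ_{n<P}τ₂²/n ≤ 16𝓛³⁶`);
`|ϖ₁ⱼ(n₁)| ≤ Kτ₂(n₁)∏_{q∣n₁}w(q)`; Rankin's trick `1/n₁ ≤ e^{−𝓛^{1/10}/4}·n₁^{δ−1}` (`δ = 1/(4𝓛)`,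
`n₁ ≥ T = e^{𝓛^{1.1}}`); the Euler-product majorant `Σ_{𝒩(𝒬)}τ₂²∏w·n^{δ−1} ≤ exp(1280(1+c)e(log(4𝓛)+4))`
(`p^δ ≤ e` for `p < D⁴`); and `32|C_b|K𝓛³⁶exp(…) ≤ exp(𝓛^{1/10}/8)` eventually.
[cite: Zhang2022LandauSiegel, §15 p.86] -/
theorem inline15_Rankin_chi_holds (c' : ℝ) : Section15B.Inline15_Rankin c' Section15A.bChi := by
  obtain ⟨Cb, hbF⟩ := Section15A.eq15_2_holds
  obtain ⟨c₂, hc₂, C₂, h21F⟩ := Section15B.eq15_21_wide c'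
  obtain ⟨K, c, hK, hc, hϖF⟩ := norm_varpi1_le_majorant c'
  set M : ℝ := 1280 * (1 + c) * Real.exp 1 with hM
  obtain ⟨D₆, hD₆⟩ := rpow_neg_mul_ell_pow_le_inv_ell hc₂ C₂ 0
  obtain ⟨D₇, hD₇⟩ := poly_ell_le_exp_eventually (32 * |Cb| * K) M 36
  obtain ⟨D₈, hD₈⟩ := exists_nat_forall_le_ell 1
  refine ⟨1 / 8, by norm_num, 1, ?_⟩
  obtain ⟨D₀, hall⟩ := (hbF.and h21F).and hϖF
  refine ⟨max (max D₀ D₆) (max D₇ (max D₈ 2)), fun D _ χ hD hq hp hA j hj => ?_⟩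
  have hD₀ : D₀ ≤ D := le_trans (le_trans (le_max_left _ _) (le_max_left _ _)) hD
  have hD6 : D₆ ≤ D := le_trans (le_trans (le_max_right _ _) (le_max_left _ _)) hD
  have hD7 : D₇ ≤ D := le_trans (le_trans (le_max_left _ _) (le_max_right _ _)) hD
  have hD8 : D₈ ≤ D := le_trans (le_trans (le_trans (le_max_left _ _) (le_max_right _ _)) (le_max_right _ _)) hD
  have hD2 : 2 ≤ D := le_trans (le_trans (le_trans (le_max_right _ _) (le_max_right _ _)) (le_max_right _ _)) hD
  obtain ⟨⟨hbD, h21D⟩, hϖD⟩ := hall D χ hD₀ hq hp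
  have hℓ1 : 1 ≤ ell D := hD₈ D hD8
  have hℓ0 : 0 < ell D := by linarith
  have e6 : C₂ * (D : ℝ) ^ (-c₂) ≤ 1 := by
    have h := hD₆ D hD6
    rw [pow_zero, mul_one] at h
    exact h.trans (by rw [div_le_one hℓ0]; exact hℓ1)
  have e7 := hD₇ D hD7
  -- names
  set ϖ : ℕ → ℂ := Section15B.varpi1 c' χ j with hϖ
  set NP : ℕ := ⌈bigP D⌉₊ with hNP
  set Q : ℕ := frakq D with hQ
  set R : Finset ℕ := (Finset.Ico 1 NP).filter (fun n => Nat.Coprime n Q) with hRset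
  set F : Finset ℕ := (Finset.Ico 1 NP).filter (fun n₁ => n₁ ∈ nset Q) with hFset
  set f : ℕ → ℂ := fun n₁ => ϖ n₁ / (n₁ : ℂ) *
    ∑ n ∈ R, Section15A.bChi D χ (n₁ * n) * ϖ n / (n : ℂ) with hf
  -- the difference is the tail sum over `n₁ ≥ T`
  have hsplit : (∑ n₁ ∈ F, f n₁) -
      ∑ n₁ ∈ (Finset.Ico 1 NP).filter (fun n₁ : ℕ => n₁ ∈ nset Q ∧ (n₁ : ℝ) < bigT D), f n₁ =
      ∑ n₁ ∈ F.filter (fun n₁ : ℕ => ¬ ((n₁ : ℝ) < bigT D)), f n₁ := by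
    have hF2 : (Finset.Ico 1 NP).filter (fun n₁ : ℕ => n₁ ∈ nset Q ∧ (n₁ : ℝ) < bigT D) =
        F.filter (fun n₁ : ℕ => (n₁ : ℝ) < bigT D) := by
      ext n; simp only [hFset, Finset.mem_filter, and_assoc]
    rw [hF2, ← Finset.sum_filter_add_sum_filter_not F (fun n₁ : ℕ => (n₁ : ℝ) < bigT D) f]
    ring
  -- sizes on the rough inner variable
  have hτsum := sum_tau_sq_div_Ico_bigP_le (D := D) hℓ1
  have hinner : ∀ n₁ : ℕ, ‖∑ n ∈ R, Section15A.bChi D χ (n₁ * n) * ϖ n / (n : ℂ)‖ ≤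
      32 * |Cb| * ell D ^ 36 * n₁.divisors.card := by
    intro n₁
    have hterm : ∀ n ∈ R, ‖Section15A.bChi D χ (n₁ * n) * ϖ n / (n : ℂ)‖ ≤
        2 * |Cb| * n₁.divisors.card * (((n.divisors.card : ℝ)) ^ 2 / n) := by
      intro n hn
      have hn' := Finset.mem_filter.mp hn
      have hn1 : 1 ≤ n := (Finset.mem_Ico.mp hn'.1).1
      have hn0 : (0 : ℝ) < n := by exact_mod_cast hn1
      have hnP : (n : ℝ) < bigP D := by
        have := (Finset.mem_Ico.mp hn'.1).2; rw [hNP] at this; exact Nat.lt_ceil.mp this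
      -- `|b_χ(n₁ n)| ≤ |C_b| τ₂(n₁)τ₂(n)`
      have hb : ‖Section15A.bChi D χ (n₁ * n)‖ ≤ |Cb| * (n₁.divisors.card * n.divisors.card) := by
        have h1 : ‖bcoef D (n₁ * n)‖ ≤ Cb * MeanSquareMajorant.tau 2 (n₁ * n) := hbD.1 _
        rw [MeanSquareMajorant.tau_two_apply] at h1
        have h2 : ((n₁ * n).divisors.card : ℝ) ≤ n₁.divisors.card * n.divisors.card := by
          exact_mod_cast card_divisors_mul_le₂ n₁ n
        have eb : Section15A.bChi D χ (n₁ * n) = χ ((n₁ * n : ℕ) : ZMod D) * bcoef D (n₁ * n) := rfl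
        calc ‖Section15A.bChi D χ (n₁ * n)‖
            = ‖χ ((n₁ * n : ℕ) : ZMod D)‖ * ‖bcoef D (n₁ * n)‖ := by rw [eb, norm_mul]
          _ ≤ 1 * (Cb * ((n₁ * n).divisors.card : ℝ)) :=
              mul_le_mul (DirichletCharacter.norm_le_one χ _) h1 (norm_nonneg _) zero_le_one
          _ ≤ |Cb| * ((n₁ * n).divisors.card : ℝ) := by
              rw [one_mul]; exact mul_le_mul_of_nonneg_right (le_abs_self _) (Nat.cast_nonneg _)
          _ ≤ |Cb| * (n₁.divisors.card * n.divisors.card) := mul_le_mul_of_nonneg_left h2 (abs_nonneg _)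
      -- `|ϖ(n)| ≤ 2 τ₂(n)` on the rough `n < P`
      have hv : ‖ϖ n‖ ≤ 2 * n.divisors.card := by
        have h1 := h21D hA j hj n hn1 hnP hn'.2
        have h2 : ‖χ (n : ZMod D) * varrhoStar c' χ j n‖ ≤ n.divisors.card := by
          rw [norm_mul]
          calc ‖χ (n : ZMod D)‖ * ‖varrhoStar c' χ j n‖ ≤ 1 * n.divisors.card :=
                mul_le_mul (DirichletCharacter.norm_le_one χ _) (norm_varrhoStar_le c' χ j n)
                  (norm_nonneg _) zero_le_one
            _ = n.divisors.card := one_mul _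
        have h3 : C₂ * (n.divisors.card : ℝ) * (D : ℝ) ^ (-c₂) ≤ n.divisors.card := by
          have hτ0 : (0 : ℝ) ≤ n.divisors.card := Nat.cast_nonneg _
          calc C₂ * (n.divisors.card : ℝ) * (D : ℝ) ^ (-c₂) = (C₂ * (D : ℝ) ^ (-c₂)) * n.divisors.card := by
                ring
            _ ≤ 1 * n.divisors.card := mul_le_mul_of_nonneg_right e6 hτ0
            _ = n.divisors.card := one_mul _
        calc ‖ϖ n‖ = ‖(ϖ n - χ (n : ZMod D) * varrhoStar c' χ j n) + χ (n : ZMod D) * varrhoStar c' χ j n‖ := by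
              rw [sub_add_cancel]
          _ ≤ ‖ϖ n - χ (n : ZMod D) * varrhoStar c' χ j n‖ + ‖χ (n : ZMod D) * varrhoStar c' χ j n‖ :=
              norm_add_le _ _
          _ ≤ n.divisors.card + n.divisors.card := add_le_add (h1.trans h3) h2
          _ = 2 * n.divisors.card := by ring
      rw [norm_div, norm_mul, Complex.norm_natCast, div_le_iff₀ hn0]
      calc ‖Section15A.bChi D χ (n₁ * n)‖ * ‖ϖ n‖
          ≤ (|Cb| * (n₁.divisors.card * n.divisors.card)) * (2 * n.divisors.card) :=
            mul_le_mul hb hv (norm_nonneg _) (by positivity)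
        _ = 2 * |Cb| * n₁.divisors.card * (((n.divisors.card : ℝ)) ^ 2 / n) * n := by
            field_simp
    calc ‖∑ n ∈ R, Section15A.bChi D χ (n₁ * n) * ϖ n / (n : ℂ)‖
        ≤ ∑ n ∈ R, ‖Section15A.bChi D χ (n₁ * n) * ϖ n / (n : ℂ)‖ := norm_sum_le _ _
      _ ≤ ∑ n ∈ R, 2 * |Cb| * n₁.divisors.card * (((n.divisors.card : ℝ)) ^ 2 / n) :=
          Finset.sum_le_sum hterm
      _ = 2 * |Cb| * n₁.divisors.card * ∑ n ∈ R, ((n.divisors.card : ℝ)) ^ 2 / n := by rw [Finset.mul_sum]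
      _ ≤ 2 * |Cb| * n₁.divisors.card * ∑ n ∈ Finset.Ico 1 NP, ((n.divisors.card : ℝ)) ^ 2 / n := by
          refine mul_le_mul_of_nonneg_left ?_ (by positivity)
          exact Finset.sum_le_sum_of_subset_of_nonneg (Finset.filter_subset _ _) fun n _ _ => by positivity
      _ ≤ 2 * |Cb| * n₁.divisors.card * (16 * ell D ^ 36) := mul_le_mul_of_nonneg_left hτsum (by positivity)
      _ = 32 * |Cb| * ell D ^ 36 * n₁.divisors.card := by ring
  -- Rankin's exponent and the weight
  set δ : ℝ := 1 / (4 * ell D) with hδ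
  have hδ0 : 0 < δ := by rw [hδ]; positivity
  have hδhalf : δ ≤ 1 / 2 := by
    rw [hδ, div_le_iff₀ (by positivity)]; linarith
  set y : ℝ := ell D ^ (1 / 10 : ℝ) with hy
  set w : ℕ → ℝ := fun q => (1 + 8 / (q : ℝ)) * (1 + c * (q : ℝ) ^ (-(9 / 10 : ℝ))) with hw
  have hw0 : ∀ q, 0 ≤ w q := by
    intro q
    rcases Nat.lt_or_ge q 2 with hq2 | hq2
    · interval_cases q <;> (simp only [hw]; positivity)
    · exact (weight_nonneg_le hc hq2).1
  -- `T^δ = exp(𝓛^{1/10}/4)`, so `1/n₁ ≤ e^{-y/4} n₁^{δ-1}` for `n₁ ≥ T`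
  have hTδ : Real.exp (y / 4) = bigT D ^ δ := by
    rw [bigT, ← Real.exp_mul]
    congr 1
    rw [hy, hδ]
    have h11 : ell D ^ (1.1 : ℝ) = ell D ^ (1 / 10 : ℝ) * ell D := by
      rw [show (1.1 : ℝ) = 1 / 10 + 1 by norm_num, Real.rpow_add hℓ0, Real.rpow_one]
    rw [h11]; field_simp
  have hrankin : ∀ n₁ : ℕ, 1 ≤ n₁ → bigT D ≤ (n₁ : ℝ) →
      1 / (n₁ : ℝ) ≤ Real.exp (-(y / 4)) * (n₁ : ℝ) ^ (δ - 1) := by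
    intro n₁ hn₁ hT
    have hn0 : (0 : ℝ) < n₁ := by exact_mod_cast hn₁
    have hT0 : 0 < bigT D := Real.exp_pos _
    have h1 : bigT D ^ δ ≤ (n₁ : ℝ) ^ δ := Real.rpow_le_rpow hT0.le hT hδ0.le
    rw [← hTδ] at h1
    rw [Real.rpow_sub hn0, Real.rpow_one, Real.exp_neg]
    rw [div_le_iff₀ hn0, mul_assoc, div_mul_cancel₀ _ hn0.ne']
    rw [← div_eq_inv_mul, le_div_iff₀ (Real.exp_pos _), one_mul]
    exact h1
  -- the pointwise bound on the tail terms
  have hterm : ∀ n₁ ∈ F.filter (fun n₁ : ℕ => ¬ ((n₁ : ℝ) < bigT D)), ‖f n₁‖ ≤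
      (32 * |Cb| * ell D ^ 36 * K * Real.exp (-(y / 4))) *
        (((n₁.divisors.card : ℝ)) ^ 2 * (∏ q ∈ n₁.primeFactors, w q) * (n₁ : ℝ) ^ (δ - 1)) := by
    intro n₁ hn₁
    have hn₁' := Finset.mem_filter.mp hn₁
    have hn₁F := Finset.mem_filter.mp hn₁'.1
    have hn1 : 1 ≤ n₁ := (Finset.mem_Ico.mp hn₁F.1).1
    have hn0 : (0 : ℝ) < n₁ := by exact_mod_cast hn1
    have hT : bigT D ≤ (n₁ : ℝ) := not_lt.mp hn₁'.2
    have g1 := hϖD hA j hj n₁ hn1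
    have g2 := hinner n₁
    have g3 := hrankin n₁ hn1 hT
    have hτ0 : (0 : ℝ) ≤ n₁.divisors.card := Nat.cast_nonneg _
    have hW0 : 0 ≤ ∏ q ∈ n₁.primeFactors, w q := Finset.prod_nonneg fun q _ => hw0 q
    rw [hf]; simp only
    rw [norm_mul, norm_div, Complex.norm_natCast]
    calc ‖ϖ n₁‖ / (n₁ : ℝ) * ‖∑ n ∈ R, Section15A.bChi D χ (n₁ * n) * ϖ n / (n : ℂ)‖
        = ‖ϖ n₁‖ * ‖∑ n ∈ R, Section15A.bChi D χ (n₁ * n) * ϖ n / (n : ℂ)‖ * (1 / (n₁ : ℝ)) := by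
          ring
      _ ≤ (K * (n₁.divisors.card : ℝ) * ∏ q ∈ n₁.primeFactors, w q) *
          (32 * |Cb| * ell D ^ 36 * n₁.divisors.card) * (Real.exp (-(y / 4)) * (n₁ : ℝ) ^ (δ - 1)) := by
          refine mul_le_mul (mul_le_mul g1 g2 (norm_nonneg _) (by positivity)) g3 (by positivity) ?_
          positivity
      _ = (32 * |Cb| * ell D ^ 36 * K * Real.exp (-(y / 4))) *
          (((n₁.divisors.card : ℝ)) ^ 2 * (∏ q ∈ n₁.primeFactors, w q) * (n₁ : ℝ) ^ (δ - 1)) := by ring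
  -- the Euler-product majorant of the tail
  have hA : ∀ n ∈ F, n ∈ Nat.factoredNumbers (Nat.primesBelow (D ^ 4)) :=
    fun n hn => mem_factoredNumbers_of_mem_nset_frakq (Finset.mem_filter.mp hn).2
  have hprime : ∀ p ∈ Nat.primesBelow (D ^ 4), p.Prime := fun p hp => (Nat.mem_primesBelow.mp hp).2
  have ha : δ - 1 ≤ -(1 / 2 : ℝ) := by linarith
  have hmaj := sum_majorant_le_prod hw0 ha (Nat.primesBelow (D ^ 4)) hprime F hA
  have hpow : ∀ p ∈ Nat.primesBelow (D ^ 4), (p : ℝ) ^ (δ - 1) ≤ Real.exp 1 / p := by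
    intro p hp
    have hp' := Nat.mem_primesBelow.mp hp
    have hp2 : (2 : ℝ) ≤ p := by exact_mod_cast hp'.2.two_le
    have hp0 : (0 : ℝ) < p := by linarith
    have hlogp : Real.log p ≤ 4 * ell D := by
      have h4 : (p : ℝ) ≤ (D : ℝ) ^ 4 := by exact_mod_cast hp'.1.le
      have hD0 : (0 : ℝ) < D := by exact_mod_cast (show 0 < D by omega)
      calc Real.log p ≤ Real.log ((D : ℝ) ^ 4) := Real.log_le_log hp0 h4
        _ = 4 * ell D := by rw [Real.log_pow, ell]; norm_num
    have hpδ : (p : ℝ) ^ δ ≤ Real.exp 1 := by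
      rw [Real.rpow_def_of_pos hp0]
      apply Real.exp_le_exp.mpr
      rw [hδ]
      calc Real.log p * (1 / (4 * ell D)) ≤ 4 * ell D * (1 / (4 * ell D)) :=
            mul_le_mul_of_nonneg_right hlogp (by positivity)
        _ = 1 := by field_simp
    rw [Real.rpow_sub hp0, Real.rpow_one]
    exact div_le_div_of_nonneg_right hpδ hp0.le
  have hprod := prod_local_factor_le_exp hc ha (Real.exp_pos 1).le hD2 hpow
  have hsumF : ∑ n₁ ∈ F.filter (fun n₁ : ℕ => ¬ ((n₁ : ℝ) < bigT D)),
      ((n₁.divisors.card : ℝ)) ^ 2 * (∏ q ∈ n₁.primeFactors, w q) * (n₁ : ℝ) ^ (δ - 1) ≤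
      Real.exp (M * (Real.log (4 * ell D) + 4)) := by
    calc ∑ n₁ ∈ F.filter (fun n₁ : ℕ => ¬ ((n₁ : ℝ) < bigT D)),
          ((n₁.divisors.card : ℝ)) ^ 2 * (∏ q ∈ n₁.primeFactors, w q) * (n₁ : ℝ) ^ (δ - 1)
        ≤ ∑ n₁ ∈ F, ((n₁.divisors.card : ℝ)) ^ 2 * (∏ q ∈ n₁.primeFactors, w q) * (n₁ : ℝ) ^ (δ - 1) :=
          Finset.sum_le_sum_of_subset_of_nonneg (Finset.filter_subset _ _) fun n _ _ =>
            mul_nonneg (mul_nonneg (sq_nonneg _) (Finset.prod_nonneg fun q _ => hw0 q))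
              (Real.rpow_nonneg (Nat.cast_nonneg n) _)
      _ ≤ _ := hmaj
      _ ≤ Real.exp (1280 * (1 + c) * Real.exp 1 * (Real.log (4 * ell D) + 4)) := hprod
      _ = Real.exp (M * (Real.log (4 * ell D) + 4)) := by rw [hM]
  -- assemble
  rw [hsplit]
  have hconst0 : 0 ≤ 32 * |Cb| * ell D ^ 36 * K * Real.exp (-(y / 4)) := by positivity
  calc ‖∑ n₁ ∈ F.filter (fun n₁ : ℕ => ¬ ((n₁ : ℝ) < bigT D)), f n₁‖
      ≤ ∑ n₁ ∈ F.filter (fun n₁ : ℕ => ¬ ((n₁ : ℝ) < bigT D)), ‖f n₁‖ := norm_sum_le _ _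
    _ ≤ ∑ n₁ ∈ F.filter (fun n₁ : ℕ => ¬ ((n₁ : ℝ) < bigT D)),
          (32 * |Cb| * ell D ^ 36 * K * Real.exp (-(y / 4))) *
            (((n₁.divisors.card : ℝ)) ^ 2 * (∏ q ∈ n₁.primeFactors, w q) * (n₁ : ℝ) ^ (δ - 1)) :=
        Finset.sum_le_sum hterm
    _ = (32 * |Cb| * ell D ^ 36 * K * Real.exp (-(y / 4))) *
          ∑ n₁ ∈ F.filter (fun n₁ : ℕ => ¬ ((n₁ : ℝ) < bigT D)),
            ((n₁.divisors.card : ℝ)) ^ 2 * (∏ q ∈ n₁.primeFactors, w q) * (n₁ : ℝ) ^ (δ - 1) := by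
        rw [Finset.mul_sum]
    _ ≤ (32 * |Cb| * ell D ^ 36 * K * Real.exp (-(y / 4))) * Real.exp (M * (Real.log (4 * ell D) + 4)) :=
        mul_le_mul_of_nonneg_left hsumF hconst0
    _ = (32 * |Cb| * K * ell D ^ 36 * Real.exp (M * (Real.log (4 * ell D) + 4))) * Real.exp (-(y / 4)) := by
        ring
    _ ≤ Real.exp (y / 8) * Real.exp (-(y / 4)) :=
        mul_le_mul_of_nonneg_right e7 (Real.exp_nonneg _)
    _ = 1 * Real.exp (-(1 / 8) * ell D ^ (1 / 10 : ℝ)) := by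
        rw [← Real.exp_add, hy]; ring_nf

end Rankin

/-! ## 3. Leaf `h15_22` reduced to Lemma 15.1 -/

section Reduction

open scoped Classical in
/-- **(15.22) from Lemma 15.1 ALONE, generic in the value** (RT-05 / R-28 shape): for any
`E1 : ℕ → ℂ`, Lemma 15.1 (χ-reading, rate `α₁`) at the value `(E1 j + ι₂e₂ⱼ)(ῑ₃e₃ⱼ + ῑ₄e₂ⱼ)` implies
(15.22) at that value — every other input of `calS1_eval_of_parts` is now a theorem
(`inline15_Rankin_chi_holds`, `smooth_majorant_holds`, and inside it (15.19)/(15.20)/(15.21)).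
[cite: Zhang2022LandauSiegel, §15 (15.22) p.87] -/
theorem calS1_eval_of_lemma151 (c' : ℝ) (E1 : ℕ → ℂ)
    (h151 : ∃ C : ℝ, ForAllLarge fun D _ χ => AssumptionA D χ → ∀ j ∈ ({1, 2, 3} : Finset ℕ),
      ∀ n₁ : ℕ, n₁ ∈ nset (frakq D) → (n₁ : ℝ) < bigT D →
        ‖(∑ n ∈ (Finset.Ico 1 ⌈bigP D⌉₊).filter (fun n => Nat.Coprime n (frakq D)),
            χ ((n₁ * n : ℕ) : ZMod D) * bcoef D (n₁ * n) * χ (n : ZMod D) *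
              varrhoStar c' χ j n / (n : ℂ)) -
          χ (n₁ : ZMod D) * (n₁.divisors.card : ℂ) *
            ((E1 j + iota2 * e2j j) * (conj iota3 * e3j j + conj iota4 * e2j j))‖ ≤
        C * alpha1 D * n₁.divisors.card) :
    ∃ C : ℝ, ForAllLarge fun D _ χ => AssumptionA D χ → ∀ j ∈ ({1, 2, 3} : Finset ℕ),
      ‖Section15B.calS1 c' χ (Section15A.bChi D χ) j -
          (E1 j + iota2 * e2j j) * (conj iota3 * e3j j + conj iota4 * e2j j) *
            Section15B.calM1 c' χ 1 1 (1 - betaJ c' D j) *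
              sumInN c' inputs15ABchi χ j‖ ≤ C / ell D :=
  calS1_eval_of_parts c' E1 (inline15_Rankin_chi_holds c') h151 (smooth_majorant_holds c')

/-- **Leaf `h15_22` (as typed, value `frake j`) from Lemma 15.1 (χ-reading of record) ALONE**:
`Skeleton.Lemma151ChiR c′ → Typed.Section15C.Eq15_22 c′ inputs15ABchi`. (Per WP15-PLAN §2.1 the typed
`Lemma151ChiR` carries the STATED e″; the E-generic `calS1_eval_of_lemma151` is the form to instantiate
at the derived value.) [cite: Zhang2022LandauSiegel, §15 (15.22) p.87] -/
theorem eq15_22_chi_of_lemma151 (c' : ℝ) (h151 : Lemma151ChiR c') : Eq15_22 c' inputs15ABchi :=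
  eq15_22_chi_of_rankin_lemma151 c' (inline15_Rankin_chi_holds c') h151 (smooth_majorant_holds c')

end Reduction

end Literature.NumberTheory.LFunctions.Zhang2022.Typed.Section15C
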